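import Mathlib.RingTheory.Polynomial.Dickson
import Mathlib.FieldTheory.Finite.Basic
import Literature.Barriers.RiemannHypothesis.IntegralLambdaRingsCyclotomic
import HarnessLib

/-!
# The Chebyshev line: Clauwens' second Λ-structure `ψ_n(x) = D_n(x)` on `ℤ[x]` (Borger 2009 §2.5, Manin 2016 §2)

Borger's dictionary "`𝔽₁`-scheme = scheme over `ℤ` with a Λ-structure" [Borger2009LambdaF1,
Introduction] makes the affine line `Spec ℤ[x]` an `𝔽₁`-object in (at least) two ways.  The
**toric** Λ-structure is `ψ_p(x) = x^p` [Borger2009LambdaF1, §2.2: "the monoid algebra `ℤ[M]` has a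
natural Λ-action induced by `ψ_p : m ↦ m^p` … I will call this Λ-action the toric Λ-action"].  The
**Chebyshev line** [Borger2009LambdaF1, §2.5]: "Clauwens [Clauwens1994LambdaZx] has used Ritt's work
to argue that, up to isomorphism, the affine line `Spec ℤ[x]` has exactly one Λ-structure besides the
toric one … The ring `ℤ[t^{±1}]`, endowed with the toric Λ-action, has a Λ-involution `t ↦ t⁻¹` … the
fixed subring is naturally a Λ-ring.  It is freely generated as a ring by `x = t + t⁻¹`, and this
gives the other Λ-action on `ℤ[x]` … The polynomials `ψ_p(x)` are Chebychev polynomials: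
`ψ_2(x) = x² − 2, ψ_3(x) = x³ − 3x, ψ_5(x) = x⁵ − 5x³ + 5x, …`"; Manin [Manin2016LocalZetaFactors,
§2.2]: "the polynomial ring `ℤ[r]` admits one more lambda-structure discovered by Clauwens.  In this
structure, `ψ^k(r) := T_k(r)` where `T_k` is the `k`-th Chebyshev polynomial", normalised in the
proof of [Manin2016LocalZetaFactors, Prop. 2.3] by `ψ^k(r) = q^k + q^{-k} = T_k(q + q^{-1}) = T_k(r)`
— i.e. `T_k` is the DICKSON polynomial `D_k = dickson 1 1 k` of Mathlib (`D_k(t + t⁻¹) = t^k + t^{-k}`,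
`Polynomial.dickson_one_one_eval_add_inv`; `D_k(x) = 2·T_k^{classical}(x/2)`).

Everything in this file is PROVED (no named facts; D-0014/D-0026).  With the typed notion
`LambdaStructure` / `IsLambdaHom` of `IntegralLambdaRingsCyclotomic` (Borger–de Smit's working
definition: commuting ring endomorphisms `ψ_p` with `ψ_p(f) ≡ f^p (mod p)`):

* §1 `natCast_dvd_comp_sub_pow`: if `g ≡ X^p (mod p)` then `f(g) ≡ f^p (mod p ℤ[X])` for all `f`
  (via `𝔽_p[X]`, where `f(X^p) = f^p`).
* §2 `toricLine : LambdaStructure ℤ[X]`, `ψ_n(f) = f(X^n)` [Borger2009LambdaF1, §2.2].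
* §3 `chebyshevLine : LambdaStructure ℤ[X]`, `ψ_n(f) = f(D_n)`: commutation from
  `D_m ∘ D_n = D_{mn}` (`Polynomial.dickson_one_one_mul`), Frobenius lift from `D_p ≡ X^p (mod p)`
  (`Polynomial.dickson_one_one_zmod_p`); Borger's displayed `ψ_2, ψ_3, ψ_5` are checked
  (`chebyshevPsi_two/three/five`) [Borger2009LambdaF1, §2.5] [Manin2016LocalZetaFactors, §2.2].
* §4 `x = t + t⁻¹` at finite level `r`: the ring map `toCyclotomic r : ℤ[X] → ℤ[μ_r]`,
  `X ↦ z + z^{r−1}` into Borger–de Smit's model Λ-ring `ℤ[μ_r]` (`CyclotomicLambdaRing r`,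
  `ψ_n(z) = z^n`) is a Λ-MORPHISM from the Chebyshev line (`toCyclotomic_isLambdaHom`, in fact
  `ψ_n`-equivariant for every `n`), and its image is fixed by the inversion `ψ_{r−1} : z ↦ z^{r−1} = z⁻¹`
  (`psi_pred_toCyclotomic`) — the level-`r` shadow of "fixed subring of `t ↦ t⁻¹`, generated by
  `x = t + t⁻¹`" [Borger2009LambdaF1, §2.5] [Manin2016LocalZetaFactors, Prop. 2.3 (proof)].  (This is
  the finite level used by the construction census for the Chebyshev line: the `Ẑ°`-set `μ_r/±` of
  orbits `{a, −a}`, `ψ_p` induced by `a ↦ pa`, whose Lefschetz traces are fixed-orbit counts by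
  `trace_funLeft` of `IntegralLambdaRingsCyclotomic`.)
* §5 `𝔽₁`-valued points.  With `absolutePoint : LambdaStructure ℤ` (`ψ_p = id`: "The ring `ℤ` has a
  unique Λ-structure—each `ψ_p` is the identity … call `Spec ℤ`, viewed as a Λ-space, the absolute
  point" [Borger2009LambdaF1, §2.1]), the `ℤ`-valued Λ-points `Hom_Λ(ℤ[x], ℤ)` are: for the toric line
  `{x ∈ ℤ : x^p = x for all primes p} = {0, 1}` (`toric_isLambdaPoint_iff`, as printed in
  [Borger2009LambdaF1, §3.2]: "So `0` and `1` are the only `𝔽₁`-valued points of the toric `𝔸¹`"),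
  and for the Chebyshev line the single point `x = 2 = t + t⁻¹|_{t=1}` (`chebyshev_isLambdaPoint_iff`;
  cf. [Borger2009LambdaF1, Rem. 6.2]).  Consequently the two Λ-structures are NOT isomorphic — indeed
  there is no surjective Λ-morphism from the Chebyshev line to the toric line
  (`false_of_surjective_lambdaHom`, `not_isLambdaHom_ringEquiv_toric_chebyshev`,
  `not_isLambdaHom_ringEquiv_chebyshev_toric`): the "besides the toric one" clause of Clauwens'
  theorem.  Clauwens' UNIQUENESS statement (no third Λ-structure on `ℤ[x]` up to isomorphism; proof
  via Ritt's classification of commuting polynomials) is recorded here only, not typed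
  [Clauwens1994LambdaZx] [Borger2009LambdaF1, §2.5].

## References

* [Borger2009LambdaF1] J. Borger, *Λ-rings and the field with one element*, arXiv:0906.3146 (2009):
  §2.1 (the point), §2.2 (toric Λ-action), §2.5 (the Chebychev line, with the displayed `ψ_2, ψ_3,
  ψ_5`), §3.2 (`𝔽₁`-valued points of the toric `𝔸¹`), Rem. 6.2 — read in the arXiv text.
* [Manin2016LocalZetaFactors] Yu. I. Manin, *Local zeta factors and geometries under `Spec ℤ`*,
  Izv. Math. 80 (2016) 751–758 = arXiv:1407.4969: §2.2 (toric and Chebyshev lambda-structures),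
  Prop. 2.3 and its proof (`ψ^k(r) = q^k + q^{-k} = T_k(q + q^{-1})`) — read in the arXiv text.
* [Clauwens1994LambdaZx] F. J.-B. J. Clauwens, *Commuting polynomials and λ-ring structures on
  `ℤ[x]`*, J. Pure Appl. Algebra 95 (1994) 261–269 — cited through the two sources above (the
  classification itself is not used here).
* [BorgerDeSmit2008] J. Borger, B. de Smit, *Galois theory and integral models of Λ-rings*, Bull.
  LMS 40 (2008) — the model Λ-ring `ℤ[μ_r] = ℤ[z]/(z^r − 1)`, `ψ_p(z) = z^p` (typed in
  `IntegralLambdaRingsCyclotomic`).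

## Design notes

* `LambdaStructure`, `IsLambdaHom`, `CyclotomicLambdaRing` and its `psi`/`z` API are IMPORTED from
  `Literature.Barriers.RiemannHypothesis.IntegralLambdaRingsCyclotomic` (the tree's only typed
  Λ-ring notion; nothing is re-declared).  As there, `psi : ℕ → A →+* A` is indexed by all naturals
  and only prime indices carry axioms; for both lines `ψ_m ψ_n = ψ_{mn}` holds for all `m, n`.
* Mathlib's `Polynomial.dickson 1 1 n` is used for Manin's `T_n` / Borger's `ψ_n(x)`; its file
  comment anticipates exactly this use ("once [Mathlib knows what a Lambda ring is], we can endow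
  `ℤ[X]` with a Lambda structure in terms of the `dickson 1 1` polynomials").
* Mathlib/tree searches (2026-08-20): `LambdaRing`, `LambdaStructure`, `Frobenius lift`, `dickson`,
  `Chebyshev` under `Literature/` — only the barrier file above and unrelated uses; nothing restated.
-/

noncomputable section

open Polynomial

namespace Literature.RingTheory.LambdaRings

open Literature.Barriers.RiemannHypothesis

/-! ## §1. Substitution endomorphisms of `ℤ[X]` lifting the Frobenius -/

/-- If `g ≡ X^p (mod p)` coefficientwise, then the substitution `f ↦ f(g)` lifts the Frobenius:
`p ∣ f(g) − f^p` in `ℤ[X]` (in `𝔽_p[X]`, `f(X^p) = f^p`).  [cite: BorgerDeSmit2008, Introduction p. 1 (Λ-structure on a torsion-free ring = commuting Frobenius lifts)] -/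
theorem natCast_dvd_comp_sub_pow {p : ℕ} (hp : p.Prime) {g : ℤ[X]}
    (hg : g.map (Int.castRingHom (ZMod p)) = X ^ p) (f : ℤ[X]) :
    (p : ℤ[X]) ∣ f.comp g - f ^ p := by
  haveI := Fact.mk hp
  have h : (f.comp g - f ^ p).map (Int.castRingHom (ZMod p)) = 0 := by
    rw [Polynomial.map_sub, Polynomial.map_pow, map_comp, hg, ← expand_eq_comp_X_pow,
      ZMod.expand_card, sub_self]
  rw [← map_natCast C, C_dvd_iff_dvd_coeff]
  intro i
  rw [← ZMod.intCast_zmod_eq_zero_iff_dvd]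
  have := congrArg (fun q => q.coeff i) h
  simpa only [coeff_map, eq_intCast, coeff_zero] using this

/-! ## §2. The toric Λ-structure `ψ_n(x) = x^n` on `ℤ[x]` -/

/-- The toric Frobenius lifts of `𝔸¹ = Spec ℤ[x] = Spec ℤ[ℕ]`: `ψ_n(f)(x) = f(x^n)` ("`ψ_p : m ↦ m^p`
for any `m ∈ M` … the toric Λ-action"). [cite: Borger2009LambdaF1, §2.2] -/
def toricPsi (n : ℕ) : ℤ[X] →+* ℤ[X] :=
  compRingHom (X ^ n)

/-- `ψ_n(f) = f(X^n)`. [cite: Borger2009LambdaF1, §2.2] -/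
theorem toricPsi_apply (n : ℕ) (f : ℤ[X]) : toricPsi n f = f.comp (X ^ n) := rfl

/-- `ψ_n(x) = x^n`. [cite: Borger2009LambdaF1, §2.2] -/
theorem toricPsi_X (n : ℕ) : toricPsi n X = X ^ n := by
  rw [toricPsi_apply, X_comp]

/-- The toric `ψ_n` is Mathlib's `expand`. [cite: Borger2009LambdaF1, §2.2] -/
theorem toricPsi_eq_expand (n : ℕ) (f : ℤ[X]) : toricPsi n f = expand ℤ n f := by
  rw [toricPsi_apply, expand_eq_comp_X_pow]

/-- `ψ_m ψ_n = ψ_{mn}` for the toric structure. [cite: Borger2009LambdaF1, §2.2] -/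
theorem toricPsi_toricPsi (m n : ℕ) (f : ℤ[X]) : toricPsi m (toricPsi n f) = toricPsi (m * n) f := by
  simp only [toricPsi_eq_expand, expand_expand]

/-- The toric `ψ_p` lifts the Frobenius. [cite: Borger2009LambdaF1, §2.2] -/
theorem toricPsi_frobenius {p : ℕ} (hp : p.Prime) (f : ℤ[X]) : (p : ℤ[X]) ∣ toricPsi p f - f ^ p :=
  natCast_dvd_comp_sub_pow hp (by rw [Polynomial.map_pow, map_X]) f

/-- **The toric line**: `ℤ[x]` with `ψ_p(x) = x^p` is a Λ-ring. [cite: Borger2009LambdaF1, §2.2] -/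
def toricLine : LambdaStructure ℤ[X] where
  psi := toricPsi
  comm := fun _ _ f => by rw [toricPsi_toricPsi, toricPsi_toricPsi, mul_comm]
  lift := fun hp f => toricPsi_frobenius hp f

/-! ## §3. The Chebyshev Λ-structure `ψ_n(x) = D_n(x)` (Clauwens; Borger §2.5; Manin §2.2) -/

/-- The Chebyshev Frobenius lifts: `ψ_n(f)(x) = f(D_n(x))` with `D_n = dickson 1 1 n` (Manin's
`T_n`, `T_n(q + q⁻¹) = q^n + q^{-n}`). [cite: Manin2016LocalZetaFactors, §2.2] [cite: Borger2009LambdaF1, §2.5] -/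
def chebyshevPsi (n : ℕ) : ℤ[X] →+* ℤ[X] :=
  compRingHom (dickson 1 (1 : ℤ) n)

/-- `ψ_n(f) = f(D_n)`. [cite: Manin2016LocalZetaFactors, §2.2] -/
theorem chebyshevPsi_apply (n : ℕ) (f : ℤ[X]) : chebyshevPsi n f = f.comp (dickson 1 (1 : ℤ) n) := rfl

/-- `ψ_n(x) = D_n(x)` ("`ψ^k(r) := T_k(r)`"). [cite: Manin2016LocalZetaFactors, §2.2] -/
theorem chebyshevPsi_X (n : ℕ) : chebyshevPsi n X = dickson 1 (1 : ℤ) n := by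
  rw [chebyshevPsi_apply, X_comp]

/-- The Dickson recursion with parameter `1`: `D_{n+2} = x D_{n+1} − D_n`. [folklore] -/
private theorem dickson_one_one_add_two (n : ℕ) :
    dickson 1 (1 : ℤ) (n + 2) = X * dickson 1 1 (n + 1) - dickson 1 1 n := by
  rw [dickson_add_two, C_1, one_mul]

/-- `D_2 = x² − 2`. [folklore] -/
private theorem dickson_one_one_two' : dickson 1 (1 : ℤ) 2 = X ^ 2 - 2 := by
  rw [dickson_one_one_add_two 0, dickson_one, dickson_zero, Nat.cast_one]
  ring

/-- `D_3 = x³ − 3x`. [folklore] -/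
private theorem dickson_one_one_three : dickson 1 (1 : ℤ) 3 = X ^ 3 - 3 * X := by
  rw [dickson_one_one_add_two 1, dickson_one_one_two', dickson_one]
  ring

/-- `D_4 = x⁴ − 4x² + 2`. [folklore] -/
private theorem dickson_one_one_four : dickson 1 (1 : ℤ) 4 = X ^ 4 - 4 * X ^ 2 + 2 := by
  rw [dickson_one_one_add_two 2, dickson_one_one_three, dickson_one_one_two']
  ring

/-- Borger's first displayed Chebyshev lift: `ψ_2(x) = x² − 2`. [cite: Borger2009LambdaF1, §2.5] -/
theorem chebyshevPsi_two : chebyshevPsi 2 X = X ^ 2 - 2 := by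
  rw [chebyshevPsi_X, dickson_one_one_two']

/-- `ψ_3(x) = x³ − 3x`. [cite: Borger2009LambdaF1, §2.5] -/
theorem chebyshevPsi_three : chebyshevPsi 3 X = X ^ 3 - 3 * X := by
  rw [chebyshevPsi_X, dickson_one_one_three]

/-- `ψ_5(x) = x⁵ − 5x³ + 5x`. [cite: Borger2009LambdaF1, §2.5] -/
theorem chebyshevPsi_five : chebyshevPsi 5 X = X ^ 5 - 5 * X ^ 3 + 5 * X := by
  rw [chebyshevPsi_X, dickson_one_one_add_two 3, dickson_one_one_four, dickson_one_one_three]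
  ring

/-- `ψ_m ψ_n = ψ_{mn}` for the Chebyshev structure (`D_n ∘ D_m = D_{nm}`, so the `ψ^k` are "defined
for all positive integers `k` by multiplicativity"). [cite: Manin2016LocalZetaFactors, §2.2] -/
theorem chebyshevPsi_chebyshevPsi (m n : ℕ) (f : ℤ[X]) :
    chebyshevPsi m (chebyshevPsi n f) = chebyshevPsi (m * n) f := by
  rw [chebyshevPsi_apply, chebyshevPsi_apply, chebyshevPsi_apply, comp_assoc, ← dickson_one_one_mul,
    mul_comm]

/-- The Chebyshev `ψ_m, ψ_n` commute ("commuting lifts of Frobenii"). [cite: Manin2016LocalZetaFactors, §2.2] -/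
theorem chebyshevPsi_comm (m n : ℕ) (f : ℤ[X]) :
    chebyshevPsi m (chebyshevPsi n f) = chebyshevPsi n (chebyshevPsi m f) := by
  rw [chebyshevPsi_chebyshevPsi, chebyshevPsi_chebyshevPsi, mul_comm]

/-- The Chebyshev `ψ_p` lifts the Frobenius: `ψ^p(f) ≡ f^p (mod p ℤ[x])` (as `D_p ≡ x^p (mod p)`).
[cite: Manin2016LocalZetaFactors, §2.2] [cite: Borger2009LambdaF1, §2.5] -/
theorem chebyshevPsi_frobenius {p : ℕ} (hp : p.Prime) (f : ℤ[X]) :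
    (p : ℤ[X]) ∣ chebyshevPsi p f - f ^ p := by
  haveI := Fact.mk hp
  exact natCast_dvd_comp_sub_pow hp (by rw [map_dickson, map_one, dickson_one_one_zmod_p]) f

/-- **The Chebyshev line** (Clauwens' Λ-structure on `ℤ[x]`): `ψ_p(x) = D_p(x)`, the "exactly one
Λ-structure besides the toric one". [cite: Borger2009LambdaF1, §2.5] [cite: Manin2016LocalZetaFactors, §2.2]
[cite: Clauwens1994LambdaZx] -/
def chebyshevLine : LambdaStructure ℤ[X] where
  psi := chebyshevPsi
  comm := fun _ _ f => chebyshevPsi_comm _ _ f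
  lift := fun hp f => chebyshevPsi_frobenius hp f

/-! ## §4. `x = t + t⁻¹` at level `r`: the Λ-morphism from the Chebyshev line into `ℤ[μ_r]` -/

/-- `x ↦ z + z^{r−1}` (`= t + t⁻¹` with `t = z`, `z^r = 1`): the ring map from the Chebyshev line to
Borger–de Smit's model Λ-ring `ℤ[μ_r]`. [cite: Borger2009LambdaF1, §2.5 ("freely generated as a ring by `x = t + t⁻¹`")]
[cite: BorgerDeSmit2008, Introduction p. 1] -/
def toCyclotomic (r : ℕ) : ℤ[X] →+* CyclotomicLambdaRing r :=
  eval₂RingHom (Int.castRingHom _) (CyclotomicLambdaRing.z r + CyclotomicLambdaRing.z r ^ (r - 1))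

/-- `toCyclotomic r (x) = z + z^{r−1}`. [cite: Borger2009LambdaF1, §2.5] -/
theorem toCyclotomic_X (r : ℕ) :
    toCyclotomic r X = CyclotomicLambdaRing.z r + CyclotomicLambdaRing.z r ^ (r - 1) :=
  eval₂_X _ _

/-- `z · z^{r−1} = 1` in `ℤ[μ_r]` (`r ≥ 1`): `z^{r−1} = t⁻¹`. [cite: BorgerDeSmit2008, Introduction p. 1] -/
theorem z_mul_z_pow_pred {r : ℕ} (hr : 0 < r) :
    CyclotomicLambdaRing.z r * CyclotomicLambdaRing.z r ^ (r - 1) = 1 := by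
  rw [← pow_succ', Nat.sub_add_cancel hr, CyclotomicLambdaRing.z_pow_self]

/-- `D_n(t + t⁻¹) = t^n + t^{−n}` at level `r`: `toCyclotomic r (D_n) = z^n + (z^{r−1})^n`
("`ψ^k(r) = q^k + q^{-k} = T_k(q + q^{-1})`"). [cite: Manin2016LocalZetaFactors, Prop. 2.3 (proof)] -/
theorem toCyclotomic_dickson {r : ℕ} (hr : 0 < r) (n : ℕ) :
    toCyclotomic r (dickson 1 (1 : ℤ) n) =
      CyclotomicLambdaRing.z r ^ n + (CyclotomicLambdaRing.z r ^ (r - 1)) ^ n := by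
  rw [toCyclotomic, coe_eval₂RingHom, eval₂_eq_eval_map, map_dickson, map_one,
    dickson_one_one_eval_add_inv _ _ (z_mul_z_pow_pred hr)]

/-- **Equivariance**: `toCyclotomic ∘ ψ_n^{Cheb} = ψ_n ∘ toCyclotomic` for every `n` (`ψ_n(z) = z^n` on
`ℤ[μ_r]`): the Chebyshev structure is the one induced from the toric structure on the torus via
`x = t + t⁻¹`. [cite: Borger2009LambdaF1, §2.5] [cite: Manin2016LocalZetaFactors, Prop. 2.3 (i)] -/
theorem toCyclotomic_chebyshevPsi {r : ℕ} (hr : 0 < r) (n : ℕ) (f : ℤ[X]) :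
    toCyclotomic r (chebyshevPsi n f) = CyclotomicLambdaRing.psi r n (toCyclotomic r f) := by
  have h : (toCyclotomic r).comp (chebyshevPsi n) =
      (CyclotomicLambdaRing.psi r n).comp (toCyclotomic r) := by
    refine Polynomial.ringHom_ext' (RingHom.ext_int _ _) ?_
    rw [RingHom.comp_apply, RingHom.comp_apply, chebyshevPsi_X, toCyclotomic_dickson hr,
      toCyclotomic_X, map_add, map_pow, CyclotomicLambdaRing.psi_z, ← pow_mul, ← pow_mul, mul_comm]
  exact RingHom.congr_fun h f

/-- **`x ↦ t + t⁻¹` is a Λ-morphism** from the Chebyshev line to `ℤ[μ_r]` (`r ≥ 1`).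
[cite: Borger2009LambdaF1, §2.5] [cite: Manin2016LocalZetaFactors, Prop. 2.3 (i)] -/
theorem toCyclotomic_isLambdaHom {r : ℕ} (hr : 0 < r) :
    IsLambdaHom chebyshevLine (CyclotomicLambdaRing.lambdaStructure r) (toCyclotomic r) :=
  fun _ f => toCyclotomic_chebyshevPsi hr _ f

/-- `z^{(r−1)²} = z` in `ℤ[μ_r]` (`r ≥ 1`): the inversion `z ↦ z^{r−1}` is an involution. [folklore] -/
private theorem z_pow_pred_mul_pred {r : ℕ} (hr : 0 < r) :
    CyclotomicLambdaRing.z r ^ ((r - 1) * (r - 1)) = CyclotomicLambdaRing.z r := by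
  obtain ⟨k, rfl⟩ : ∃ k, r = k + 1 := ⟨r - 1, by omega⟩
  rcases k with _ | j
  · have h1 : CyclotomicLambdaRing.z 1 = 1 := by
      simpa using CyclotomicLambdaRing.z_pow_self 1
    simp [h1]
  · have e : (j + 1 + 1 - 1) * (j + 1 + 1 - 1) = 1 + (j + 1 + 1) * j := by
      rw [Nat.add_sub_cancel]
      ring
    rw [e, pow_add, pow_one, pow_mul, CyclotomicLambdaRing.z_pow_self, one_pow, mul_one]

/-- The image of the Chebyshev line in `ℤ[μ_r]` is fixed by the inversion `ψ_{r−1} : z ↦ z^{r−1} = z⁻¹`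
("the fixed subring" of `t ↦ t⁻¹`). [cite: Borger2009LambdaF1, §2.5] -/
theorem psi_pred_toCyclotomic {r : ℕ} (hr : 0 < r) (f : ℤ[X]) :
    CyclotomicLambdaRing.psi r (r - 1) (toCyclotomic r f) = toCyclotomic r f := by
  have h : (CyclotomicLambdaRing.psi r (r - 1)).comp (toCyclotomic r) = toCyclotomic r := by
    refine Polynomial.ringHom_ext' (RingHom.ext_int _ _) ?_
    rw [RingHom.comp_apply, toCyclotomic_X, map_add, map_pow, CyclotomicLambdaRing.psi_z, ← pow_mul,
      z_pow_pred_mul_pred hr, add_comm]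
  exact RingHom.congr_fun h f

/-! ## §5. `𝔽₁`-valued points: `{0, 1}` for the toric line, `{2}` for the Chebyshev line; non-isomorphism -/

/-- **The absolute point** `Spec 𝔽₁ := Spec ℤ` with its unique Λ-structure, "each `ψ_p` is the
identity" (the Frobenius-lift condition is Fermat's little theorem). [cite: Borger2009LambdaF1, §2.1] -/
def absolutePoint : LambdaStructure ℤ where
  psi := fun _ => RingHom.id ℤ
  comm := fun _ _ _ => rfl
  lift := fun {p} hp x => by
    haveI := Fact.mk hp
    rw [RingHom.id_apply, ← ZMod.intCast_zmod_eq_zero_iff_dvd]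
    push_cast
    rw [ZMod.pow_card, sub_self]

/-- A ring map `ℤ[X] → ℤ` is evaluation at the image of `X`. [folklore] -/
private theorem ringHom_eq_evalRingHom (φ : ℤ[X] →+* ℤ) : φ = evalRingHom (φ X) :=
  Polynomial.ringHom_ext' (RingHom.ext_int _ _) (by rw [coe_evalRingHom, eval_X])

/-- Evaluation at `a ∈ {0, 1}` is invariant under the toric `ψ_n` (`n ≥ 1`): `a^n = a`. [cite: Borger2009LambdaF1, §3.2] -/
theorem evalRingHom_toricPsi {a : ℤ} (ha : a = 0 ∨ a = 1) {n : ℕ} (hn : n ≠ 0) (g : ℤ[X]) :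
    evalRingHom a (toricPsi n g) = evalRingHom a g := by
  have hapow : a ^ n = a := by
    rcases ha with rfl | rfl
    exacts [zero_pow hn, one_pow n]
  rw [coe_evalRingHom, toricPsi_apply, eval_comp, eval_pow, eval_X, hapow]

/-- **`𝔽₁`-valued points of the toric `𝔸¹`**: "The `ℤ`-valued Λ-points of `𝔸¹` are in bijection with
`Hom_Λ(ℤ[x], ℤ)`, which agrees with `{x ∈ ℤ : x^p = x for all primes p} = {0, 1}`. So `0` and `1` are
the only `𝔽₁`-valued points of the toric `𝔸¹`." [cite: Borger2009LambdaF1, §3.2] -/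
theorem toric_isLambdaPoint_iff (φ : ℤ[X] →+* ℤ) :
    IsLambdaHom toricLine absolutePoint φ ↔ φ X = 0 ∨ φ X = 1 := by
  constructor
  · intro h
    have h2 : φ (toricPsi 2 X) = φ X := h Nat.prime_two X
    rw [toricPsi_X, map_pow] at h2
    have h0 : φ X * (φ X - 1) = 0 := by linear_combination h2
    rcases mul_eq_zero.mp h0 with h0 | h1
    · exact Or.inl h0
    · exact Or.inr (sub_eq_zero.mp h1)
  · obtain ⟨a, rfl⟩ : ∃ a, φ = evalRingHom a := ⟨φ X, ringHom_eq_evalRingHom φ⟩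
    intro ha p hp f
    simp only [coe_evalRingHom, eval_X] at ha
    exact evalRingHom_toricPsi ha hp.ne_zero f

/-- Evaluation at `2 = t + t⁻¹|_{t = 1}` is invariant under every Chebyshev `ψ_n` (`D_n(2) = 1^n + 1^n`).
[cite: Manin2016LocalZetaFactors, Prop. 2.3 (proof)] -/
theorem evalRingHom_two_chebyshevPsi (n : ℕ) (g : ℤ[X]) :
    evalRingHom 2 (chebyshevPsi n g) = evalRingHom 2 g := by
  have h2 : (dickson 1 (1 : ℤ) n).eval 2 = 2 := by
    have := dickson_one_one_eval_add_inv (1 : ℤ) 1 (one_mul 1) n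
    norm_num at this
    exact this
  rw [coe_evalRingHom, chebyshevPsi_apply, eval_comp, h2]

/-- **`𝔽₁`-valued points of the Chebyshev line**: `Hom_Λ(ℤ[x]_{Cheb}, ℤ)` is the single point `x = 2`
(`x² − 2 = x` and `x³ − 3x = x` force `x = 2`; Borger: the Chebychev line "has no complemented
`𝔽₁`-valued points"). [cite: Borger2009LambdaF1, §3.2 and Rem. 6.2] -/
theorem chebyshev_isLambdaPoint_iff (φ : ℤ[X] →+* ℤ) :
    IsLambdaHom chebyshevLine absolutePoint φ ↔ φ X = 2 := by
  constructor
  · intro h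
    have e2 : φ (chebyshevPsi 2 X) = φ X := h Nat.prime_two X
    have e3 : φ (chebyshevPsi 3 X) = φ X := h Nat.prime_three X
    rw [chebyshevPsi_two, map_sub, map_pow] at e2
    rw [chebyshevPsi_three, map_sub, map_mul, map_pow] at e3
    simp only [map_ofNat] at e2 e3
    linear_combination (1 + φ X) * e2 - e3
  · obtain ⟨a, rfl⟩ : ∃ a, φ = evalRingHom a := ⟨φ X, ringHom_eq_evalRingHom φ⟩
    intro ha p _ f
    simp only [coe_evalRingHom, eval_X] at ha
    subst ha
    exact evalRingHom_two_chebyshevPsi p f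

/-- **No surjective Λ-morphism from the Chebyshev line onto the toric line**: pulling back the two
toric `𝔽₁`-points `x = 0, 1` along it would give two distinct Chebyshev `𝔽₁`-points, but there is only
`x = 2`. [cite: Borger2009LambdaF1, §2.5 and §3.2] [cite: Clauwens1994LambdaZx] -/
theorem false_of_surjective_lambdaHom (σ : ℤ[X] →+* ℤ[X]) (hσ : Function.Surjective σ)
    (hΛ : IsLambdaHom chebyshevLine toricLine σ) : False := by
  have hpt : ∀ a : ℤ, a = 0 ∨ a = 1 → (evalRingHom a).comp σ = evalRingHom 2 := by
    intro a ha
    have hΛpt : IsLambdaHom chebyshevLine absolutePoint ((evalRingHom a).comp σ) := by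
      intro p hp f
      have step : σ (chebyshevPsi p f) = toricPsi p (σ f) := hΛ hp f
      show evalRingHom a (σ (chebyshevPsi p f)) = evalRingHom a (σ f)
      rw [step, evalRingHom_toricPsi ha hp.ne_zero]
    have hX := (chebyshev_isLambdaPoint_iff _).mp hΛpt
    rw [ringHom_eq_evalRingHom ((evalRingHom a).comp σ), hX]
  have h01 : evalRingHom (0 : ℤ) = evalRingHom 1 :=
    (RingHom.cancel_right hσ).mp ((hpt 0 (Or.inl rfl)).trans (hpt 1 (Or.inr rfl)).symm)
  have hX := RingHom.congr_fun h01 X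
  simp only [coe_evalRingHom, eval_X] at hX
  exact zero_ne_one hX

/-- **The toric and the Chebyshev Λ-structures on `ℤ[x]` are not isomorphic** (no ring automorphism
of `ℤ[x]` is a Λ-morphism toric → Chebyshev): the "besides the toric one" clause of Clauwens'
theorem. [cite: Borger2009LambdaF1, §2.5] [cite: Clauwens1994LambdaZx] -/
theorem not_isLambdaHom_ringEquiv_toric_chebyshev (σ : ℤ[X] ≃+* ℤ[X]) :
    ¬ IsLambdaHom toricLine chebyshevLine (σ : ℤ[X] →+* ℤ[X]) := by
  intro h
  refine false_of_surjective_lambdaHom (σ.symm : ℤ[X] →+* ℤ[X])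
    (fun y => ⟨σ y, σ.symm_apply_apply y⟩) ?_
  intro p hp x
  show σ.symm (chebyshevPsi p x) = toricPsi p (σ.symm x)
  apply σ.injective
  have step : σ (toricPsi p (σ.symm x)) = chebyshevPsi p (σ (σ.symm x)) := h hp (σ.symm x)
  rw [σ.apply_symm_apply, step, σ.apply_symm_apply]

/-- … nor Chebyshev → toric. [cite: Borger2009LambdaF1, §2.5] [cite: Clauwens1994LambdaZx] -/
theorem not_isLambdaHom_ringEquiv_chebyshev_toric (σ : ℤ[X] ≃+* ℤ[X]) :
    ¬ IsLambdaHom chebyshevLine toricLine (σ : ℤ[X] →+* ℤ[X]) :=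
  fun h => false_of_surjective_lambdaHom _ (fun y => ⟨σ.symm y, σ.apply_symm_apply y⟩) h

end Literature.RingTheory.LambdaRings
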